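import Literature.IUT.HodgeArakelov.PlusMinusTowerCoverModelCompletion
import Literature.AnabelianGeometry.EtaleTheta.DoubleUnderlineTower
import HarnessLib

/-!
# B15b, TOWER SIDE at the level `Π_v`: `Π̂_v` of the genuine tower `ofCoverModel` / `ofPiCHat` IS a profinite completion of
# `Π_v = Π^tp_{X̲̲_v}` through `emb ∘ incl`

S. Mochizuki, *Inter-universal Teichmüller Theory II*, kurims manuscript (Dec. 2020), §2, Def 2.3 (i) p. 67 («denote the respective
profinite completions by means of a “∧”»: `Π̂_v` is the profinite completion of `Π_v = Π^tp_{X̲̲_v}`); [SemiAnbd] §6 p. 69 («`∧` denotes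
profinite completion, or, equivalently, closure in `Π_{X_K}`»; here: closure in `Π̂_C`) [cite: Mochizuki2012, II Def 2.3 (i) p.67]
[cite: MochizukiSemiAnbd2006, §6 p.69].  abc-iut cell, MERGE-MAP row **B15b** «common-model identification at `v ∈ 𝕍^bad`, level `Π_v`»
(abc-iut-L6-lead §F v1.19al «B15-XUU-TOWER»; holder abc-iut-L6-t19 gen 6): the `Π_v`-level TWIN of abc-iut-w5-d132's
`PlusMinusTowerCoverModelCompletion.lean` (p431233, level `Π^±_v`).  PROOF-ONLY (no `def`; the bundled map `embHatV` is produced inside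
an `∃`).  Over abc-iut-L6-t19's genuine tower (B14, `PlusMinusTowerCoverModel.lean` p430122) BY NAME.

* `PlusMinusTower.index_map_inclX_Huu` — `[Π^tp_C : inclX(Π^tp_{X̲̲_v})] = 2·l²` (`[Π^tp_C : Π^tp_X] = 2`, abc-iut-L2-t1's
  `index_range_inclX`; `[Π^tp_X : Π^tp_{X̲̲_v}] = l²`, abc-iut-L2-t8's `DoubleUnderline.index_Huu`);
* `PlusMinusTower.isOpen_map_inclX_Huu`, `PlusMinusTower.exists_continuousMulEquiv_map_inclX` — `inclX(Π^tp_{X̲̲_v}) ≤ Π^tp_C` is open and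
  `H ≅ inclX(H)` as TOPOLOGICAL groups for every subgroup `H ≤ Π^tp_X` (`inclX` an embedding, abc-iut-L2-d3 `continuous_ofInjective_symm`);
* **`PlusMinusTower.exists_embHatV_ofCoverModel`** — for the parametric tower over ANY injective profinite completion `ι : Π^tp_C → Q`:
  `∃ embHatV : Π_v(P) →ₜ* Π̂_v, (embHatV = emb ∘ incl on the nose) ∧ IsProfiniteCompletion embHatV` — abc-iut-L2-d1's «closure = completion»
  (`IsProfiniteCompletion.exists_restrict_of_isOpen_of_finiteIndex`) at the open index-`2l²` subgroup `inclX(Π^tp_{X̲̲_v})`, transported along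
  the source isomorphism `P ≅ Π^tp_{X̲̲_v} ≅ inclX(Π^tp_{X̲̲_v})` (`refIso`, p430122) by `comp_continuousMulEquiv_source` (p430970);
* `PlusMinusTower.exists_embHatV_ofPiCHat`, `PlusMinusTower.continuous_aug_hat_ofPiCHat` — the tower of record inside abc-iut-L2-d3's `Π_C`.

Nothing of the series is asserted; no side taken on [IUTchIII] Cor 3.12; constructed ≠ the paper's reconstruction algorithms.
-/

noncomputable section

namespace Literature.IUT.HodgeArakelov

open Literature.AnabelianGeometry.EtaleTheta Literature.AnabelianGeometry.SemiGraphs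
open scoped Pointwise

namespace PlusMinusTower

variable {p : ℕ} [Fact p.Prime] {M : MuTwoSetting p} (e : M.CLevelData)
  {E : M.toThetaSetting.EtaleThetaData} {l : ℕ} (C : E.DoubleUnderline l) {N : ℕ+}
  (μ : M.toThetaSetting.CyclotomeMod l N) (hC : M.toThetaSetting.Compat) (hS : M.toThetaSetting.Sec2Hyps)
  (hl : l.Prime) (hp2 : p ≠ 2) (hpl : p ≠ l) (hζ : ∃ ζ : M.toThetaSetting.K, IsPrimitiveRoot ζ (4 * l))
  {η : (C.thetaEnvData μ hC hS).PiYdd → MuN p N} (hη : η ∈ (C.thetaEnvData μ hC hS).thetaCocycles)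
  {Q : Type} [Group Q] [TopologicalSpace Q] [IsTopologicalGroup Q]
  (ι : M.GtpC →ₜ* Q) (hι : IsProfiniteCompletion ι) (hinj : Function.Injective ι)
  (Φ : Q →* GQp p) (hΦ : ∀ g : M.GtpC, Φ (ι g) = e.augC g) (hΦK : Φ.range = M.GK)
  (hZ : Thm16Sub.KerToZIsCompactlyGenerated M.toThetaSetting) (hN : (C.Huu.subgroupOf (M.GtpXu l)).Normal)
  {P : TopGroup.{0}} (T : TemperedCoverings (BadPlaceSetting.ofUnderline C μ hC hS hl hp2 hpl hζ hη) P)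

include C in
omit [IsTopologicalGroup Q] in
/-- `[Π^tp_C : inclX(Π^tp_{X̲̲_v})] = 2·l²`: `[Π^tp_C : Π^tp_X] = 2` (abc-iut-L2-t1's `index_range_inclX`) times `[Π^tp_X : Π^tp_{X̲̲_v}] = l²`
(abc-iut-L2-t8's `DoubleUnderline.index_Huu`), `inclX` injective.  PROVED. [cite: MochizukiEtTh2009, Prop 2.2 (iii) p.37] -/
theorem index_map_inclX_Huu : (C.Huu.map M.inclX).index = 2 * l ^ 2 := by
  rw [Subgroup.index_map, (MonoidHom.ker_eq_bot_iff M.inclX).mpr M.injective_inclX, sup_bot_eq,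
    M.index_range_inclX, C.index_Huu, mul_comm]

include e in
omit [IsTopologicalGroup Q] in
/-- `inclX(Π^tp_{X̲̲_v}) ≤ Π^tp_C` is open (`inclX` an open embedding, `Π^tp_{X̲̲_v}` open in `Π^tp_X`). [cite: MochizukiEtTh2009, Def 2.1 p.36] -/
theorem isOpen_map_inclX_Huu : IsOpen ((C.Huu.map M.inclX : Subgroup M.GtpC) : Set M.GtpC) := by
  rw [Subgroup.coe_map]
  exact e.isOpenEmbedding_inclX.isOpenMap _ C.isOpen_Huu

include e in
omit [IsTopologicalGroup Q] in
/-- `H ≅ inclX(H)` as TOPOLOGICAL groups, for every subgroup `H ≤ Π^tp_X` (`inclX` is an embedding: the inverse is continuous by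
abc-iut-L2-d3's `continuous_ofInjective_symm`).  Existence form (no `def`); abc-iut-w5-d132's `exists_continuousMulEquiv_GtpXu_map` (p431233)
is the case `H = Π^tp_{X̲_v}`. [cite: MochizukiEtTh2009, Def 2.1 p.36] -/
theorem exists_continuousMulEquiv_map_inclX (H : Subgroup M.PiTemp) :
    ∃ κ : ↥H ≃ₜ* ↥(H.map M.inclX), ∀ y, ((κ y : H.map M.inclX) : M.GtpC) = M.inclX y := by
  let κ₀ : ↥H ≃* ↥(H.map M.inclX) := Subgroup.equivMapOfInjective _ M.inclX M.injective_inclX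
  have hκ₀ : ∀ y, ((κ₀ y : H.map M.inclX) : M.GtpC) = M.inclX y := fun _ => rfl
  have hcont : Continuous κ₀ :=
    ((M.continuous_inclX.comp continuous_subtype_val).subtype_mk _)
  have hcont' : Continuous κ₀.symm := by
    have hval : Continuous fun z : ↥(H.map M.inclX) => ((κ₀.symm z : H) : M.PiTemp) := by
      have hfun : (fun z : ↥(H.map M.inclX) => ((κ₀.symm z : H) : M.PiTemp)) =
          (fun z : ↥(H.map M.inclX) => (MonoidHom.ofInjective M.injective_inclX).symm
            ⟨(z : M.GtpC), Subgroup.map_le_range _ _ z.2⟩) := by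
        funext z
        apply M.injective_inclX
        rw [MonoidHom.apply_ofInjective_symm]
        change M.inclX ((κ₀.symm z : H) : M.PiTemp) = (z : M.GtpC)
        rw [← hκ₀, MulEquiv.apply_symm_apply]
      rw [hfun]
      exact e.continuous_ofInjective_symm.comp (continuous_subtype_val.subtype_mk _)
    exact hval.subtype_mk _
  exact ⟨{ κ₀ with continuous_toFun := hcont, continuous_invFun := hcont' }, hκ₀⟩

include hι hinj in
/-- **`Π̂_v` IS a profinite completion of `Π_v` through `emb ∘ incl`** for the parametric genuine tower `ofCoverModel`: there is a
continuous homomorphism `embHatV : P → Π̂_v` equal to `emb ∘ incl` on the nose which is a profinite completion — «closure in `Π̂_C` =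
completion» for the open index-`2l²` subgroup `inclX(Π^tp_{X̲̲_v}) ≤ Π^tp_C` (abc-iut-L2-d1 `exists_restrict_of_isOpen_of_finiteIndex`),
transported along `refIso : P ≅ Π^tp_{X̲̲_v}` and `inclX`.  PROVED.  (`Π_v`-level twin of abc-iut-w5-d132's `exists_embHat_ofCoverModel`.)
([IUTchII] Def 2.3 (i), kurims p.67) [cite: Mochizuki2012, II Def 2.3 (i) p.67] [cite: MochizukiSemiAnbd2006, §6 p.69] -/
theorem exists_embHatV_ofCoverModel :
    ∃ embHatV : P →ₜ* ↥(ofCoverModel e C μ hC hS hl hp2 hpl hζ hη ι hι hinj Φ hΦ hΦK hZ hN T).hat,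
      (∀ x, ((embHatV x : (ofCoverModel e C μ hC hS hl hp2 hpl hζ hη ι hι hinj Φ hΦ hΦK hZ hN T).hat) :
          (ofCoverModel e C μ hC hS hl hp2 hpl hζ hη ι hι hinj Φ hΦ hΦK hZ hN T).Corhat) =
        (ofCoverModel e C μ hC hS hl hp2 hpl hζ hη ι hι hinj Φ hΦ hΦK hZ hN T).emb (T.incl x)) ∧
      IsProfiniteCompletion embHatV := by
  -- the open finite-index subgroup `U := inclX(Π^tp_{X̲̲_v})` of `Π^tp_C` and L2-d1's restricted completion
  haveI : (C.Huu.map M.inclX).FiniteIndex :=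
    ⟨by rw [index_map_inclX_Huu C]; exact mul_ne_zero two_ne_zero (pow_ne_zero 2 C.l_ne_zero)⟩
  obtain ⟨ιU, hιU, hιUc⟩ := hι.exists_restrict_of_isOpen_of_finiteIndex (C.Huu.map M.inclX)
    (isOpen_map_inclX_Huu e C)
  obtain ⟨κ, hκ⟩ := exists_continuousMulEquiv_map_inclX e C.Huu
  -- the source isomorphism `P ≅ Π^tp_{X̲̲_v} ≅ inclX(Π^tp_{X̲̲_v})`
  let ψ : P ≃ₜ* ↥(C.Huu.map M.inclX) := T.refIso.trans κ
  let embHatV : P →ₜ* ↥(((C.Huu.map M.inclX).map ι.toMonoidHom).topologicalClosure) :=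
    ιU.comp ⟨ψ.toMulEquiv.toMonoidHom, ψ.continuous⟩
  refine ⟨embHatV, fun x => ?_, IsProfiniteCompletion.comp_continuousMulEquiv_source hιUc ψ embHatV fun _ => rfl⟩
  change ((ιU (ψ x) : ((C.Huu.map M.inclX).map ι.toMonoidHom).topologicalClosure) : Q) =
    coverModelEmb C μ hC hS hl hp2 hpl hζ hη ι T (T.incl x)
  rw [hιU, coverModelEmb_apply, T.plainIso_incl]
  change ι ((κ (T.refIso x) : C.Huu.map M.inclX) : M.GtpC) = ι (M.inclX (T.refIso x).1)
  rw [hκ]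

/-- **The tower of record `ofPiCHat`: `Π̂_v ⊆ Π_C` is a profinite completion of `Π_v` through `emb ∘ incl`** (instance of
`exists_embHatV_ofCoverModel` at abc-iut-L2-d3's `toPiCHat`).  ([IUTchII] Def 2.3 (i), kurims p.67) [cite: Mochizuki2012, II Def 2.3 (i) p.67] -/
theorem exists_embHatV_ofPiCHat :
    ∃ embHatV : P →ₜ* ↥(ofPiCHat e C μ hC hS hl hp2 hpl hζ hη hZ hN T).hat,
      (∀ x, ((embHatV x : (ofPiCHat e C μ hC hS hl hp2 hpl hζ hη hZ hN T).hat) :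
          (ofPiCHat e C μ hC hS hl hp2 hpl hζ hη hZ hN T).Corhat) = (ofPiCHat e C μ hC hS hl hp2 hpl hζ hη hZ hN T).emb (T.incl x)) ∧
      IsProfiniteCompletion embHatV :=
  exists_embHatV_ofCoverModel e C μ hC hS hl hp2 hpl hζ hη e.toPiCHat e.isProfiniteCompletion_toPiCHat e.toPiCHat_injective
    e.piCData.aug.toMonoidHom (fun g => e.piCData_aug_apply g) e.piCData.range_aug hZ hN T

/-- The augmentation of the tower of record is continuous on `Π̂_v` (`piCData.aug` is continuous).
([IUTchII] Def 2.3 (i), kurims p.67) [cite: Mochizuki2012, II Def 2.3 (i) p.67] -/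
theorem continuous_aug_hat_ofPiCHat :
    Continuous ((ofPiCHat e C μ hC hS hl hp2 hpl hζ hη hZ hN T).aug.comp
      (ofPiCHat e C μ hC hS hl hp2 hpl hζ hη hZ hN T).hat.subtype) := by
  change Continuous fun g : ↥(ofPiCHat e C μ hC hS hl hp2 hpl hζ hη hZ hN T).hat =>
    coverModelAug C μ hC hS hl hp2 hpl hζ hη e.piCData.aug.toMonoidHom e.piCData.range_aug g.1
  exact (e.piCData.aug.continuous.subtype_mk _).comp continuous_subtype_val

end PlusMinusTower

end Literature.IUT.HodgeArakelov

end
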